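import Mathlib.Geometry.Euclidean.Angle.Unoriented.TriangleInequality
import Literature.Geometry.DiscreteGeometry.PolygonalConeVertices
import Literature.Geometry.DiscreteGeometry.SphericalExcessEuler
import HarnessLib

/-!
# The vertex angles of a convex polygonal cone are sums of fan-triangle angles

Topic `Literature/Geometry/DiscreteGeometry`.  For a cyclically positively oriented family
`w 0, …, w (n−1) ∈ ℝ³` (`n ≥ 3`) the polygonal cone `polyCone n w` is subdivided by the fan of
trihedral cones `cone (w 0, w (i+1), w (i+2))`, `i < n − 2` (`SphericalPolygonFan.lean`).  Its
vertex angles `polyDih n w k = ∠(perpTo (w k) (w (k−1)), perpTo (w k) (w (k+1)))`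
(`SphericalPolygonArea.lean`) split accordingly — EXACTLY, by the equality case of the triangle
inequality for angles (Mathlib's `angle_eq_angle_add_add_angle_add_of_mem_span`): at the apex
`w 0` the polygon angle is the sum of the `n − 2` fan angles, at a vertex `w k` with
`2 ≤ k ≤ n − 2` it is the sum of the two fan angles meeting there, and at `w 1`, `w (n−1)` it is
a single fan angle.

* `perpTo_mem_span_of_orient3_pos` — the key: if `det[a;x;y], det[a;y;z], det[a;x;z] > 0`
  (seen from `a`, the ray `y` lies strictly inside the angle `< π` from `x` to `z`) then the
  component of `y` orthogonal to `a` is a nonnegative combination of those of `x` and `z`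
  (Cramer's rule `orient3_expand`, projected by the linear map `perpTo a`);
* `angle_perpTo_add` — hence `∠(pₓ, p_z) = ∠(pₓ, p_y) + ∠(p_y, p_z)` for `p_v = perpTo a v`;
* `angle_perpTo_zero_eq_sum` (the angle at `w 0` from `w 1` to `w (k+1)` is the sum of the
  first `k` fan angles), `polyDih_zero_eq_sum`, `polyDih_eq_add` (`2 ≤ k ≤ n − 2`),
  `polyDih_one_eq`, `polyDih_last_eq` — the vertex angles of the polygon in terms of the
  angles of the fan triangles `(w 0, w (i+1), w (i+2))` at that vertex.

With `SphericalCodeHullVertexAngles.sum_facetAngleAt` (the facet angles at a vertex of the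
hull of a spherical code sum to `2π`) this yields the node equations of the fan-refined Delaunay
triangulation: the angles of the fan triangles around a vertex sum to `2π` ("the angles around
each node sum to `2π`", Hales, arXiv:1209.6043, proof of Lemma 9).  Everything is PROVED; no
named facts.

## References
* A.-M. Legendre, *Éléments de géométrie* (1794), VII. [folklore]
* T. C. Hales, arXiv:1209.6043 (2012), proof of Lemma 9. [`Hales2012`]
-/

noncomputable section

namespace Literature.Geometry.DiscreteGeometry

open Real RealInnerProductSpace InnerProductGeometry Finset

local notation "E3" => EuclideanSpace ℝ (Fin 3)

/-! ### Part 1. Projections of vectors inside a planar angle -/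

section Span

/-- **A vector angularly between two others projects into their planar cone.**  If
`det[a;x;y] > 0`, `det[a;y;z] > 0` and `det[a;x;z] > 0`, then
`perpTo a y ∈ cone (perpTo a x, perpTo a z)` (nonnegative span). [folklore] -/
theorem perpTo_mem_span_of_orient3_pos {a x y z : E3} (hxy : 0 < orient3 a x y)
    (hyz : 0 < orient3 a y z) (hxz : 0 < orient3 a x z) :
    perpTo a y ∈ Submodule.span NNReal {perpTo a x, perpTo a z} := by
  -- Cramer: `det[a;x;z] • y = det[y;x;z] • a + det[a;y;z] • x + det[a;x;y] • z`, projected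
  have hexp := orient3_expand a x z y
  have hproj := congrArg (perpTo a) hexp
  rw [perpTo_smul_right, perpTo_add_right, perpTo_add_right, perpTo_smul_right,
    perpTo_smul_right, perpTo_smul_right, perpTo_self, smul_zero, zero_add] at hproj
  have hy : perpTo a y = (orient3 a y z / orient3 a x z) • perpTo a x +
      (orient3 a x y / orient3 a x z) • perpTo a z := by
    have h := congrArg (fun v => (orient3 a x z)⁻¹ • v) hproj
    simp only [smul_add, smul_smul, inv_mul_cancel₀ hxz.ne', one_smul] at h
    rw [h, div_eq_inv_mul, div_eq_inv_mul]
  rw [hy, Submodule.mem_span_pair]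
  exact ⟨⟨orient3 a y z / orient3 a x z, (div_pos hyz hxz).le⟩,
    ⟨orient3 a x y / orient3 a x z, (div_pos hxy hxz).le⟩, rfl⟩

/-- **Additivity of the projected angles**: under the same hypotheses,
`∠(perpTo a x, perpTo a z) = ∠(perpTo a x, perpTo a y) + ∠(perpTo a y, perpTo a z)`.
[folklore] -/
theorem angle_perpTo_add {a x y z : E3} (hxy : 0 < orient3 a x y) (hyz : 0 < orient3 a y z)
    (hxz : 0 < orient3 a x z) :
    angle (perpTo a x) (perpTo a z) =
      angle (perpTo a x) (perpTo a y) + angle (perpTo a y) (perpTo a z) := by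
  have hli : LinearIndependent ℝ ![a, y] :=
    linearIndependent_pair_of_triple₁₂ (linearIndependent_of_orient3_ne_zero hyz.ne')
  exact angle_eq_angle_add_add_angle_add_of_mem_span (perpTo_ne_zero hli)
    (perpTo_mem_span_of_orient3_pos hxy hyz hxz)

end Span

/-! ### Part 2. The fan decomposition of the vertex angles of a polygonal cone -/

section Fan

variable {n : ℕ} {w : ℕ → E3}

/-- **The angle at the apex `w 0` from `w 1` to `w (k+1)` is the sum of the first `k` fan
angles** (`1 ≤ k`, `k + 1 < n`). [folklore] -/
theorem angle_perpTo_zero_eq_sum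
    (hw : ∀ i j k, i < j → j < k → k < n → 0 < orient3 (w i) (w j) (w k)) {k : ℕ} (hk1 : 1 ≤ k)
    (hk : k + 1 < n) :
    angle (perpTo (w 0) (w 1)) (perpTo (w 0) (w (k + 1))) =
      ∑ i ∈ range k, angle (perpTo (w 0) (w (i + 1))) (perpTo (w 0) (w (i + 2))) := by
  induction k with
  | zero => omega
  | succ k ih =>
    rcases Nat.eq_zero_or_pos k with rfl | hkpos
    · simp
    · rw [sum_range_succ, ← ih hkpos (by omega)]
      exact angle_perpTo_add (hw 0 1 (k + 1) (by omega) (by omega) (by omega))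
        (hw 0 (k + 1) (k + 1 + 1) (by omega) (by omega) hk) (hw 0 1 (k + 1 + 1) (by omega)
        (by omega) hk)

/-- **The vertex angle of the polygon at the apex `w 0` is the sum of the `n − 2` fan angles.**
[folklore] -/
theorem polyDih_zero_eq_sum (hn : 3 ≤ n)
    (hw : ∀ i j k, i < j → j < k → k < n → 0 < orient3 (w i) (w j) (w k)) :
    polyDih n w 0 =
      ∑ i ∈ range (n - 2), angle (perpTo (w 0) (w (i + 1))) (perpTo (w 0) (w (i + 2))) := by
  rw [← angle_perpTo_zero_eq_sum hw (by omega) (by omega), polyDih, angle_comm]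
  congr 2
  · rw [Nat.zero_add, Nat.mod_eq_of_lt (by omega : 1 < n)]
  · rw [Nat.zero_add, Nat.mod_eq_of_lt (by omega : n - 1 < n)]
    congr 1; omega

/-- **At a vertex `w k` with `2 ≤ k ≤ n − 2` the polygon angle is the sum of the two fan
angles meeting there** (of the fan triangles `(w 0, w (k−1), w k)` and `(w 0, w k, w (k+1))`).
[folklore] -/
theorem polyDih_eq_add (hn : 3 ≤ n)
    (hw : ∀ i j k, i < j → j < k → k < n → 0 < orient3 (w i) (w j) (w k)) {k : ℕ} (h2 : 2 ≤ k)
    (hk : k + 2 ≤ n) :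
    polyDih n w k = angle (perpTo (w k) (w (k - 1))) (perpTo (w k) (w 0)) +
      angle (perpTo (w k) (w 0)) (perpTo (w k) (w (k + 1))) := by
  have e1 : (k + n - 1) % n = k - 1 := by
    rw [show k + n - 1 = (k - 1) + n by omega, Nat.add_mod_right, Nat.mod_eq_of_lt (by omega)]
  have e2 : (k + 1) % n = k + 1 := Nat.mod_eq_of_lt (by omega)
  rw [polyDih, e1, e2]
  -- seen from `w k` the ray `w 0` lies strictly inside the angle from `w (k+1)` to `w (k−1)`
  -- (this is the positive orientation at `w k`)
  have h1 : 0 < orient3 (w k) (w (k + 1)) (w 0) := by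
    have := hw 0 k (k + 1) (by omega) (by omega) (by omega)
    rwa [orient3_cyclic] at this
  have h2 : 0 < orient3 (w k) (w 0) (w (k - 1)) := by
    have := hw 0 (k - 1) k (by omega) (by omega) (by omega)
    rwa [orient3_cyclic, orient3_cyclic] at this
  have h3 : 0 < orient3 (w k) (w (k + 1)) (w (k - 1)) := by
    have := hw (k - 1) k (k + 1) (by omega) (by omega) (by omega)
    rwa [orient3_cyclic] at this
  have h := angle_perpTo_add h1 h2 h3
  rw [angle_comm] at h
  rw [h, angle_comm (perpTo (w k) (w (k + 1))) (perpTo (w k) (w 0)),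
    angle_comm (perpTo (w k) (w 0)) (perpTo (w k) (w (k - 1))), add_comm]

/-- **At `w 1` the polygon angle is the angle of the first fan triangle `(w 0, w 1, w 2)`.**
[folklore] -/
theorem polyDih_one_eq (hn : 3 ≤ n) :
    polyDih n w 1 = angle (perpTo (w 1) (w 0)) (perpTo (w 1) (w 2)) := by
  rw [polyDih, show 1 + n - 1 = n by omega, Nat.mod_self, Nat.mod_eq_of_lt (by omega : 2 < n)]

/-- **At `w (n−1)` the polygon angle is the angle of the last fan triangle
`(w 0, w (n−2), w (n−1))`.** [folklore] -/
theorem polyDih_last_eq (hn : 3 ≤ n) :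
    polyDih n w (n - 1) = angle (perpTo (w (n - 1)) (w (n - 2))) (perpTo (w (n - 1)) (w 0)) := by
  rw [polyDih, show n - 1 + n - 1 = (n - 2) + n by omega, Nat.add_mod_right,
    Nat.mod_eq_of_lt (by omega : n - 2 < n), show n - 1 + 1 = n by omega, Nat.mod_self]

end Fan

end Literature.Geometry.DiscreteGeometry

end
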